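import Mathlib.RingTheory.MvPolynomial.Basic
import Mathlib.LinearAlgebra.Eigenspace.Minpoly
import Literature.NumberTheory.Automorphic.IdentityComponent
import Literature.NumberTheory.Transcendental.OmegaDegree
import HarnessLib

/-!
# Right translations on `k[GL_n]`: the group as stabiliser of its ideal (Springer 2.3.5–2.3.6)

Trunk T-AUTOMORPHIC (G25 AutomorphicL); companion of `LinearAlgebraicGroups.lean` and
`IdentityComponent.lean` (namespace `Literature.Automorphic`, concrete `k`-points vocabulary: the
coordinates `glCoordFun = (x i j, det⁻¹)` on `GL n k`, polynomials `MvPolynomial (GLCoord n) k`,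
vanishing ideals `MvPolynomial.vanishingIdeal k (glCoordFun '' G)`). The representation of
`GL n k` on its coordinate algebra by right translations (Springer, *Linear Algebraic Groups*,
2nd ed., 2.3.5: `(ρ(x) f)(g) = f(g x)`), realised on the polynomial ring `k[x_{ij}, det⁻¹]` by
the linear substitution `x_{ij} ↦ ∑ₗ x_{il} x_{lj}`, `det⁻¹ ↦ det⁻¹ (det x)⁻¹`:

* `rTransPolyGL`, `rTransGL x : k[x_{ij}, det⁻¹] →ₐ k[x_{ij}, det⁻¹]`, `eval_rTransGL`
  (`(ρ(x) p)(g) = p(g x)`), `rTransGL_mul`, `rTransGL_one`, the representation `rTransRep`;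
* **`mem_of_rTransGL_vanishingIdeal`** — an algebraic subgroup `G` is the stabiliser of its
  ideal `𝓘(G)` (Springer 2.3.6, proof; Humphreys 8.5), with `rTransGL_mem_vanishingIdeal`
  (`𝓘(G)` is `G`-stable) — the principle behind the Jordan decomposition in `G` (2.4.8) and
  Chevalley's 5.5.3;
* local finiteness (Springer 2.3.6 (i)): `ρ(x)` does not raise the total degree
  (`totalDegree_rTransGL_le`, via `Literature.NumberTheory.Transcendental.totalDegree_bind₁_le_of_le_one` of
  `Transcendental/OmegaDegree.lean`, imported for that purpose), so it preserves the
  finite-dimensional pieces `k[x_{ij}, det⁻¹]_{≤ d}` (Mathlib `MvPolynomial.restrictTotalDegree`):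
  the representations `rTransRepDeg d : GL n k →* End_k k[x_{ij}, det⁻¹]_{≤ d}`;
* diagonal matrices act diagonally on monomials (`rTransGL_diagonalGL_monomial`, weights
  `diagWeightGL`; Springer 3.2.2), hence **`isSemisimple_rTransRepDeg_diagonalGL`**: `ρ(t)` is
  semisimple on each `k[x_{ij}, det⁻¹]_{≤ d}` for `t ∈ 𝔻ₙ` (the semisimple half of 2.4.8).

## Mathlib

`MvPolynomial.bind₁`, `MvPolynomial.vanishingIdeal`, `MvPolynomial.restrictTotalDegree` (with
its `Module.Finite` instance), `MvPolynomial.totalDegree`, `Finsupp.finite_of_degree_le`,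
`Module.End.IsSemisimple`, `Module.End.isSemisimple_of_squarefree_aeval_eq_zero`,
`Module.End.aeval_apply_of_hasEigenvector`, `Polynomial.separable_prod_X_sub_C_iff'` are Mathlib's. Mathlib has no algebraic groups; nothing here duplicates a Mathlib declaration.

## References

* [SpringerLAG1998] T. A. Springer, *Linear Algebraic Groups*, 2nd ed., Progress in
  Mathematics 9, Birkhäuser (1998): 2.3.5, 2.3.6, 2.4.2 (ii), 2.4.8, 3.2.2.
-/

open scoped MatrixGroups

namespace Literature.NumberTheory.Automorphic

variable {k : Type*} [Field k] {n : Type*} [Fintype n] [DecidableEq n]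

/-! ### Right translations on the coordinate ring of `GL n` -/

section RightTranslation

/-- The (linear) substitution of coordinates realising right translation by `x ∈ GL n k`:
the coordinates of `g x` as polynomials in the coordinates of `g` — `x i j ↦ ∑ₗ x i l · x_{l j}`,
`det⁻¹ ↦ det⁻¹ · (det x)⁻¹` (Springer 2.3.5: `(ρ(x) f)(g) = f(g x)`). [folklore] -/
noncomputable def rTransPolyGL (x : GL n k) : GLCoord n → MvPolynomial (GLCoord n) k
  | Sum.inl ij => ∑ l, MvPolynomial.X (Sum.inl (ij.1, l)) * MvPolynomial.C ((x : Matrix n n k) l ij.2)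
  | Sum.inr _ => MvPolynomial.X (Sum.inr ()) * MvPolynomial.C (Matrix.det (x : Matrix n n k))⁻¹

/-- `rTransPolyGL x` is the right-hand twin of `leftMulPolyGL` (`IdentityComponent.lean`): the
multiplication polynomials `mulPolyGL` with the second factor specialised to `x`. [folklore] -/
theorem rTransPolyGL_eq_bind₁_mulPolyGL (x : GL n k) (c : GLCoord n) :
    rTransPolyGL x c = MvPolynomial.bind₁
      (Sum.elim MvPolynomial.X (fun d => MvPolynomial.C (glCoordFun x d))) (mulPolyGL c) := by
  rcases c with ⟨i, j⟩ | u
  · simp [rTransPolyGL, mulPolyGL]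
  · simp [rTransPolyGL, mulPolyGL]

/-- `rTransPolyGL x` computes the coordinates of `g x`. [folklore] -/
theorem eval_rTransPolyGL (x g : GL n k) (c : GLCoord n) :
    MvPolynomial.eval (glCoordFun g) (rTransPolyGL x c) = glCoordFun (g * x) c := by
  rcases c with ⟨i, j⟩ | u
  · simp [rTransPolyGL, Matrix.mul_apply]
  · simp [rTransPolyGL, Matrix.det_mul, mul_comm]

/-- **Right translation** `ρ(x) : f ↦ (g ↦ f (g x))` on the polynomial ring `k[x_{ij}, det⁻¹]`
in the coordinates of `GL n`, as a `k`-algebra endomorphism (Springer 2.3.5). [folklore] -/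
noncomputable def rTransGL (x : GL n k) :
    MvPolynomial (GLCoord n) k →ₐ[k] MvPolynomial (GLCoord n) k :=
  MvPolynomial.bind₁ (rTransPolyGL x)

/-- `(ρ(x) p)(g) = p (g x)`. [folklore] -/
theorem eval_rTransGL (x g : GL n k) (p : MvPolynomial (GLCoord n) k) :
    MvPolynomial.eval (glCoordFun g) (rTransGL x p) = MvPolynomial.eval (glCoordFun (g * x)) p := by
  rw [rTransGL, eval_bind₁]
  exact congrArg (fun f => MvPolynomial.eval f p) (funext (eval_rTransPolyGL x g))

/-- The substitutions compose like the group law: substituting the coordinates of `g x` into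
the coordinates of `g y` gives the coordinates of `g (x y)` — an identity of polynomials.
[folklore] -/
theorem bind₁_rTransPolyGL (x y : GL n k) (c : GLCoord n) :
    MvPolynomial.bind₁ (rTransPolyGL x) (rTransPolyGL y c) = rTransPolyGL (x * y) c := by
  rcases c with ⟨i, j⟩ | u
  · simp only [rTransPolyGL, map_sum, map_mul, MvPolynomial.bind₁_X_right, MvPolynomial.bind₁_C_right,
      Units.val_mul, Matrix.mul_apply, Finset.sum_mul, map_sum]
    rw [Finset.sum_comm]
    refine Finset.sum_congr rfl fun m _ => ?_
    rw [Finset.mul_sum]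
    refine Finset.sum_congr rfl fun l _ => ?_
    ring
  · simp only [rTransPolyGL, map_mul, MvPolynomial.bind₁_X_right, MvPolynomial.bind₁_C_right,
      Units.val_mul, Matrix.det_mul, mul_inv, map_mul]
    ring

/-- `ρ(x y) = ρ(x) ∘ ρ(y)`. [folklore] -/
theorem rTransGL_mul (x y : GL n k) : rTransGL (x * y) = (rTransGL x).comp (rTransGL y) := by
  apply MvPolynomial.algHom_ext
  intro c
  simp only [rTransGL, AlgHom.comp_apply, MvPolynomial.bind₁_X_right]
  rw [← bind₁_rTransPolyGL x y c]

/-- `ρ(1) = id`. [folklore] -/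
theorem rTransGL_one : rTransGL (1 : GL n k) = AlgHom.id k _ := by
  apply MvPolynomial.algHom_ext
  intro c
  rcases c with ⟨i, j⟩ | u
  · simp only [rTransGL, MvPolynomial.bind₁_X_right, rTransPolyGL, Units.val_one, AlgHom.coe_id, id_eq]
    rw [Finset.sum_eq_single j]
    · simp
    · intro l _ hl
      simp [Matrix.one_apply_ne hl]
    · intro h
      exact absurd (Finset.mem_univ j) h
  · simp [rTransGL, rTransPolyGL]

/-- Right translation as a representation `GL n k → End_k k[x_{ij}, det⁻¹]` (Springer 2.3.5).
[folklore] -/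
noncomputable def rTransRep : GL n k →* Module.End k (MvPolynomial (GLCoord n) k) where
  toFun x := (rTransGL x).toLinearMap
  map_one' := by
    rw [rTransGL_one]
    rfl
  map_mul' x y := by
    rw [rTransGL_mul]
    rfl

/-- `rTransRep x p = ρ(x) p`. [folklore] -/
@[simp] lemma rTransRep_apply (x : GL n k) (p : MvPolynomial (GLCoord n) k) :
    rTransRep x p = rTransGL x p := rfl

/-! ### The vanishing ideal is stable, and the group is its stabiliser -/

/-- Right translation by an element of `G` preserves the vanishing ideal `𝓘(G)`
(Springer 2.3.6, proof). [folklore] -/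
theorem rTransGL_mem_vanishingIdeal {G : Subgroup (GL n k)} {x : GL n k} (hx : x ∈ G)
    {p : MvPolynomial (GLCoord n) k}
    (hp : p ∈ MvPolynomial.vanishingIdeal k (glCoordFun '' (G : Set (GL n k)))) :
    rTransGL x p ∈ MvPolynomial.vanishingIdeal k (glCoordFun '' (G : Set (GL n k))) := by
  rw [mem_vanishingIdeal_glCoordFun_iff] at hp ⊢
  intro g hg
  rw [eval_rTransGL]
  exact hp _ (G.mul_mem hg hx)

/-- **An algebraic group is the stabiliser of its ideal under right translations**
(Springer 2.3.6 / Humphreys 8.5, the principle behind 2.4.8 and 5.5.3): if `ρ(x)` maps `𝓘(G)`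
into itself then `x ∈ G` (evaluate at `e`). [folklore] -/
theorem mem_of_rTransGL_vanishingIdeal {G : Subgroup (GL n k)} (hG : IsAlgebraicSubgroup G)
    {x : GL n k}
    (h : ∀ p ∈ MvPolynomial.vanishingIdeal k (glCoordFun '' (G : Set (GL n k))),
      rTransGL x p ∈ MvPolynomial.vanishingIdeal k (glCoordFun '' (G : Set (GL n k)))) :
    x ∈ G := by
  obtain ⟨S, hS⟩ := hG
  have hx : x ∈ zeroLocusGL (MvPolynomial.vanishingIdeal k (glCoordFun '' (G : Set (GL n k))) :
      Set (MvPolynomial (GLCoord n) k)) := by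
    intro p hp
    have h1 := mem_vanishingIdeal_glCoordFun_iff.1 (h p hp) 1 G.one_mem
    rwa [eval_rTransGL, one_mul] at h1
  rw [zeroLocusGL_vanishingIdeal hS] at hx
  exact hx

/-! ### Degrees: the finite-dimensional stable pieces `k[x_{ij}, det⁻¹]_{≤ d}` -/

/-- The substitution polynomials of `ρ(x)` have total degree `≤ 1`. [folklore] -/
lemma totalDegree_rTransPolyGL_le (x : GL n k) (c : GLCoord n) :
    (rTransPolyGL x c).totalDegree ≤ 1 := by
  have hXC : ∀ (v : GLCoord n) (a : k),
      (MvPolynomial.X v * MvPolynomial.C a : MvPolynomial (GLCoord n) k).totalDegree ≤ 1 := by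
    intro v a
    refine (MvPolynomial.totalDegree_mul _ _).trans ?_
    rw [MvPolynomial.totalDegree_X, MvPolynomial.totalDegree_C]
  rcases c with ⟨i, j⟩ | u
  · exact (MvPolynomial.totalDegree_finsetSum _ _).trans (Finset.sup_le fun l _ => hXC _ _)
  · exact hXC _ _

/-- `ρ(x)` does not raise the total degree (a substitution by polynomials of degree `≤ 1`,
`Literature.NumberTheory.Transcendental.totalDegree_bind₁_le_of_le_one` of `Transcendental/OmegaDegree.lean`).
[folklore] -/
theorem totalDegree_rTransGL_le (x : GL n k) (p : MvPolynomial (GLCoord n) k) :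
    (rTransGL x p).totalDegree ≤ p.totalDegree :=
  Literature.NumberTheory.Transcendental.totalDegree_bind₁_le_of_le_one (totalDegree_rTransPolyGL_le x) p

/-- Hence `ρ(x)` preserves the finite-dimensional subspaces `k[x_{ij}, det⁻¹]_{≤ d}` of
polynomials of total degree `≤ d` (Mathlib `MvPolynomial.restrictTotalDegree`; Springer 2.3.6:
`k[G]` is a union of finite-dimensional `G`-stable subspaces). [folklore] -/
theorem rTransGL_mem_restrictTotalDegree (x : GL n k) {d : ℕ} {p : MvPolynomial (GLCoord n) k}
    (hp : p ∈ MvPolynomial.restrictTotalDegree (GLCoord n) k d) :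
    rTransGL x p ∈ MvPolynomial.restrictTotalDegree (GLCoord n) k d := by
  rw [MvPolynomial.mem_restrictTotalDegree] at hp ⊢
  exact (totalDegree_rTransGL_le x p).trans hp

/-- The representation of `GL n k` on `k[x_{ij}, det⁻¹]_{≤ d}` by right translations
(Springer 2.3.6). [folklore] -/
noncomputable def rTransRepDeg (d : ℕ) :
    GL n k →* Module.End k (MvPolynomial.restrictTotalDegree (GLCoord n) k d) where
  toFun x := (rTransGL x).toLinearMap.restrict fun p hp => rTransGL_mem_restrictTotalDegree x hp
  map_one' := by
    apply LinearMap.ext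
    intro p
    apply Subtype.ext
    simp [LinearMap.restrict_apply, rTransGL_one]
  map_mul' x y := by
    apply LinearMap.ext
    intro p
    apply Subtype.ext
    simp [LinearMap.restrict_apply, rTransGL_mul]

/-- `rTransRepDeg d x p = ρ(x) p`. [folklore] -/
@[simp] lemma coe_rTransRepDeg_apply (d : ℕ) (x : GL n k)
    (p : MvPolynomial.restrictTotalDegree (GLCoord n) k d) :
    ((rTransRepDeg d x p : MvPolynomial.restrictTotalDegree (GLCoord n) k d) :
      MvPolynomial (GLCoord n) k) = rTransGL x p := rfl

/-! ### Diagonal matrices act diagonally on monomials -/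

/-- The weight by which right translation by `diag d` multiplies the coordinate `c`:
`x_{ij} ↦ d_j`, `det⁻¹ ↦ (∏ d_i)⁻¹`. [folklore] -/
def diagWeightGL (dg : n → kˣ) : GLCoord n → k
  | Sum.inl ij => ((dg ij.2 : kˣ) : k)
  | Sum.inr _ => (∏ i, ((dg i : kˣ) : k))⁻¹

/-- On coordinates, `ρ(diag d)` is the scaling `x_c ↦ w(c) x_c`. [folklore] -/
lemma rTransPolyGL_diagonalGL (dg : n → kˣ) (c : GLCoord n) :
    rTransPolyGL (diagonalGL n k dg) c = MvPolynomial.X c * MvPolynomial.C (diagWeightGL dg c) := by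
  rcases c with ⟨i, j⟩ | u
  · simp only [rTransPolyGL, coe_diagonalGL, Matrix.diagonal_apply, diagWeightGL]
    rw [Finset.sum_eq_single j]
    · simp
    · intro l _ hl
      simp [hl]
    · intro h
      exact absurd (Finset.mem_univ j) h
  · simp [rTransPolyGL, diagWeightGL, Matrix.det_diagonal]

/-- **Right translation by a diagonal matrix multiplies each monomial by a scalar**: the
monomial basis of `k[x_{ij}, det⁻¹]` consists of eigenvectors of `ρ(diag d)` (Springer 3.2.2 /
2.4.2: the weights of `𝔻ₙ` on `k[GL_n]`). [folklore] -/
theorem rTransGL_diagonalGL_monomial (dg : n → kˣ) (m : GLCoord n →₀ ℕ) (a : k) :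
    rTransGL (diagonalGL n k dg) (MvPolynomial.monomial m a) =
      (m.prod fun c e => diagWeightGL dg c ^ e) • MvPolynomial.monomial m a := by
  classical
  rw [rTransGL, MvPolynomial.bind₁_monomial, MvPolynomial.smul_eq_C_mul, MvPolynomial.monomial_eq,
    Finsupp.prod, Finsupp.prod]
  simp_rw [rTransPolyGL_diagonalGL, mul_pow, Finset.prod_mul_distrib, ← map_pow, ← map_prod]
  ring

/-! ### `ρ(diag d)` is diagonalisable on each `k[x_{ij}, det⁻¹]_{≤ d}` -/

/-- If `R v = μ v` then `q(R) v = q(μ) v` (Mathlib's `Module.End.aeval_apply_of_hasEigenvector`,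
extended to `v = 0`). [folklore] -/
private lemma aeval_apply_of_apply_eq_smul {V : Type*} [AddCommGroup V] [Module k V]
    {R : Module.End k V} {μ : k} {v : V} (hv : R v = μ • v) (q : Polynomial k) :
    Polynomial.aeval R q v = q.eval μ • v := by
  by_cases h0 : v = 0
  · simp [h0]
  · exact Module.End.aeval_apply_of_hasEigenvector ⟨Module.End.mem_eigenspace_iff.2 hv, h0⟩

/-- **`ρ(t)` is semisimple on `k[x_{ij}, det⁻¹]_{≤ d}` for diagonal `t`** (the monomials are a
basis of eigenvectors; Springer 2.4.2 (ii) / 3.2.2). [folklore] -/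
theorem isSemisimple_rTransRepDeg_diagonalGL (d : ℕ) (dg : n → kˣ) :
    (rTransRepDeg (k := k) d (diagonalGL n k dg)).IsSemisimple := by
  classical
  set R := rTransRepDeg (k := k) d (diagonalGL n k dg) with hR
  -- the finitely many weights of the monomials of degree `≤ d`
  set wt : (GLCoord n →₀ ℕ) → k := fun m => m.prod fun c e => diagWeightGL dg c ^ e with hwt
  set W : Finset k := (Finsupp.finite_of_degree_le (σ := GLCoord n) d).toFinset.image wt with hW
  set q : Polynomial k := ∏ μ ∈ W, (Polynomial.X - Polynomial.C μ) with hq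
  have hqsep : q.Separable := Polynomial.separable_prod_X_sub_C_iff'.2 fun x _ y _ h => h
  refine Module.End.isSemisimple_of_squarefree_aeval_eq_zero hqsep.squarefree ?_
  -- `q(R)` kills every monomial of degree `≤ d`, hence everything
  apply LinearMap.ext
  intro p
  apply Subtype.ext
  rw [LinearMap.zero_apply, Submodule.coe_zero]
  have hp : (p : MvPolynomial (GLCoord n) k) ∈ MvPolynomial.restrictTotalDegree (GLCoord n) k d := p.2
  -- decompose `p` into monomials
  have hsum : (p : MvPolynomial (GLCoord n) k) =
      ∑ m ∈ (p : MvPolynomial (GLCoord n) k).support,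
        MvPolynomial.monomial m ((p : MvPolynomial (GLCoord n) k).coeff m) :=
    (MvPolynomial.support_sum_monomial_coeff _).symm
  have hmem : ∀ m ∈ (p : MvPolynomial (GLCoord n) k).support, ∀ c : k,
      MvPolynomial.monomial m c ∈ MvPolynomial.restrictTotalDegree (GLCoord n) k d := by
    intro m hm c
    rw [MvPolynomial.mem_restrictTotalDegree]
    refine (MvPolynomial.totalDegree_monomial_le _ _).trans ?_
    exact (MvPolynomial.le_totalDegree hm).trans ((MvPolynomial.mem_restrictTotalDegree _ _ _).1 hp)
  -- on a monomial, `R` is the scalar `wt m`, so `q(R)` is the scalar `q(wt m) = 0`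
  have hmono : ∀ m (hm : m ∈ (p : MvPolynomial (GLCoord n) k).support) (c : k),
      Polynomial.aeval R q ⟨MvPolynomial.monomial m c, hmem m hm c⟩ = 0 := by
    intro m hm c
    have hev : R ⟨MvPolynomial.monomial m c, hmem m hm c⟩ =
        wt m • ⟨MvPolynomial.monomial m c, hmem m hm c⟩ := by
      apply Subtype.ext
      rw [hR, coe_rTransRepDeg_apply, Submodule.coe_smul, rTransGL_diagonalGL_monomial]
    rw [aeval_apply_of_apply_eq_smul hev, hq, Polynomial.eval_prod]
    have hdeg : m ∈ (Finsupp.finite_of_degree_le (σ := GLCoord n) d).toFinset := by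
      rw [Set.Finite.mem_toFinset, Set.mem_setOf_eq]
      exact (MvPolynomial.le_totalDegree hm).trans ((MvPolynomial.mem_restrictTotalDegree _ _ _).1 hp)
    have h0 : ∏ μ ∈ W, (Polynomial.X - Polynomial.C μ).eval (wt m) = 0 := by
      refine Finset.prod_eq_zero (i := wt m) (Finset.mem_image_of_mem wt hdeg) ?_
      simp
    rw [h0, zero_smul]
  -- assemble
  have hpeq : p = ∑ m ∈ (p : MvPolynomial (GLCoord n) k).support.attach,
      (⟨MvPolynomial.monomial m.1 ((p : MvPolynomial (GLCoord n) k).coeff m.1), hmem m.1 m.2 _⟩ :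
        MvPolynomial.restrictTotalDegree (GLCoord n) k d) := by
    apply Subtype.ext
    rw [Submodule.coe_sum]
    conv_lhs => rw [hsum]
    rw [← Finset.sum_attach]
  rw [hpeq, map_sum, Submodule.coe_sum]
  refine Finset.sum_eq_zero fun m _ => ?_
  rw [hmono m.1 m.2, Submodule.coe_zero]

end RightTranslation

end Literature.NumberTheory.Automorphic
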